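import Summits.BirchSwinnertonDyer.BirchSwinnertonDyer.Theorems.PrintCFramBottomClassIndexLawFiveLeEisensteinPairUnique
import Summits.BirchSwinnertonDyer.BirchSwinnertonDyer.Theorems.PrintCFramBottomClassIndexLawFiveLeKrizLiBinders
import HarnessLib

/-!
# Crux `PrintCFram.BottomClassIndexLawFiveLe` (stmt-BirchSwinnertonDyer-20372), line `eisenstein-resource-bdp-line` (registry v10):
# UNIQUENESS OF THE EISENSTEIN PAIR, part II — Kriz–Li's hypothesis (4) is INTRINSIC to `(W, p, K'')`
# (cell `bsd-print-cfram`, width seat `bsd-line-cfram-p1-w3` g3; THEOREMS ONLY, `--supports` 20372; BSD is not proved by any of this)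

HONEST FRAMING. Nothing here is a statement about BSD; no stub of the skeleton is closed. Part I (`…EisensteinPairUnique`)
proved: two character data `(f₁, ψ₁)`, `(f₂, ψ₂)` with congruent trace forms `ψ(ℓ) + ψ⁻¹(ℓ)ω(ℓ)` (mod `p`) at all primes
`ℓ ∤ N` satisfy `ψ₂↑ = ψ₁↑ ∨ ψ₂↑ = ψ₁⁻¹↑·ω↑` at a common level. THIS FILE draws the consequence for Kriz–Li Thm. 1.20: the
Bernoulli characters `ψ₀⁻¹ε_K` (`bernoulliCharOne`) and `ψ₀ω⁻¹` (`bernoulliCharTwo`), lifted to a common level, are EQUAL in the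
first case and SWAPPED in the second (`ω` odd; the parity of `ψ₀`'s definition flips with `ψ ↔ ψ⁻¹ω`, FMS §7.1 «interchange ψ and
ψ⁻¹ω»), so the Bernoulli numbers of the primitive characters (`bernoulliOnePrim`, invariant under `changeLevel` — w2 g4) have the
same PRODUCT: hypothesis (4) `¬ ‖B_{1,ψ₀⁻¹ε_K}·B_{1,ψ₀ω⁻¹}‖ ≤ p⁻¹` holds for one admissible `ψ` iff it holds for any other
(`krizLi_hypothesis_four_iff_of_traceForm_congr`). §5 packages this ON THE CLASS: two `hss` for the same member give the same
Bernoulli product (`bernoulliOnePrim_prod_eq_of_hss`); **WLOG `ψ` ODD** — any datum `(f, ψ)` with `hss ∧ (4)` may be replaced by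
w3 g2's explicit odd primitive class character with `hss ∧ (1) ∧ (3) ∧ (4)` (`exists_odd_krizLiData_of_hss`; the printed
«interchange ψ and ψ⁻¹ω», FMS §7.1 — the form Stub H's six-term Bernoulli bookkeeping wants); and (4) fails for every datum once it
fails for one character with `hss` (`krizLi_hypothesis_four_fails_of_hss`, used off the locus). With parts `…BernoulliIntegral*`
(a non-unit class factor kills (4)) this decides the locus boundary of v10 (Stub H on the locus / pair-sum + β1 off it) BY NAME.

beyond-print theorem: NO. References: [KrizLi2019] §1.5 (ψ₀), Thm. 1.20 (p. 8), §7.1 (p. 43); [Washington1997] §5.1.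
-/

set_option autoImplicit false
set_option linter.dupNamespace false

noncomputable section

open scoped Classical
open WeierstrassCurve DirichletCharacter Literature.NumberTheory.EllipticCurves
  Literature.NumberTheory.EllipticCurves.Rank1Residual Literature.NumberTheory.EllipticCurves.KrizLi2019
  Summit.BirchSwinnertonDyer.BirchSwinnertonDyer.Theorems.PrintCFram.BernoulliIntegral

namespace Summit.BirchSwinnertonDyer.BirchSwinnertonDyer.Theorems.PrintCFram.EisensteinPair

variable {p : ℕ} [hp : Fact p.Prime]

/-! ### Commutative-group bookkeeping for the swap `ψ ↔ ψ⁻¹ω` (via `Additive` and `abel`) -/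

/-- `((a⁻¹b)c)⁻¹c = ab⁻¹` in a commutative group. [folklore] -/
theorem cg_swap_one {G : Type*} [CommGroup G] (a b c : G) : ((a⁻¹ * b) * c)⁻¹ * c = a * b⁻¹ := by
  apply (Additive.ofMul (α := G)).injective
  simp only [ofMul_mul, ofMul_inv]
  abel

/-- `(a⁻¹b)⁻¹c = (ac)b⁻¹` in a commutative group. [folklore] -/
theorem cg_swap_two {G : Type*} [CommGroup G] (a b c : G) : (a⁻¹ * b)⁻¹ * c = (a * c) * b⁻¹ := by
  apply (Additive.ofMul (α := G)).injective
  simp only [ofMul_mul, ofMul_inv]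
  abel

/-- `((a⁻¹b)c)b⁻¹ = a⁻¹c` in a commutative group. [folklore] -/
theorem cg_swap_three {G : Type*} [CommGroup G] (a b c : G) : ((a⁻¹ * b) * c) * b⁻¹ = a⁻¹ * c := by
  apply (Additive.ofMul (α := G)).injective
  simp only [ofMul_mul, ofMul_inv]
  abel

/-- `(a⁻¹b)b⁻¹ = (ac)⁻¹c` in a commutative group. [folklore] -/
theorem cg_swap_four {G : Type*} [CommGroup G] (a b c : G) : (a⁻¹ * b) * b⁻¹ = (a * c)⁻¹ * c := by
  apply (Additive.ofMul (α := G)).injective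
  simp only [ofMul_mul, ofMul_inv]
  abel

/-! ## §4 Consequence: Kriz–Li's Bernoulli pair `{B_{1,ψ₀⁻¹ε_K}, B_{1,ψ₀ω⁻¹}}` does not depend on the admissible `ψ` -/

section Bernoulli

variable {f₁ f₂ d M L : ℕ}

/-- Parity is read off the lift: `(changeLevel ψ)(−1) = ψ(−1)`. [folklore] -/
theorem changeLevel_apply_neg_one {f M : ℕ} [NeZero M] (h : f ∣ M) (ψ : DirichletCharacter ℚ_[p] f) :
    changeLevel h ψ (-1) = ψ (-1) := by
  have e : ((-1 : (ZMod M)ˣ) : ZMod M) = -1 := by rw [Units.val_neg, Units.val_one]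
  rw [← e, changeLevel_eq_cast_of_dvd ψ h, e, ZMod.cast_neg h, ZMod.cast_one h]

/-- An odd `p`-adic character is not even (`1 ≠ −1` in `ℚ_p`). [folklore] -/
theorem not_even_of_odd' {f : ℕ} (ψ : DirichletCharacter ℚ_[p] f) (hψ : ψ.Odd) : ¬ ψ.Even := by
  intro h
  have : (1 : ℚ_[p]) = -1 := h.symm.trans hψ
  have h2 : (2 : ℚ_[p]) = 0 := by linear_combination this
  exact two_ne_zero h2

/-- Lift of `ψ₀⁻¹ε_K` (`bernoulliCharOne`) to a common level. [cite: KrizLi2019, §1.5 (p. 7, ψ₀) and Thm. 1.20 (p. 8)] -/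
theorem changeLevel_bernoulliCharOne {f d L : ℕ} [NeZero L] (hf : f ∣ L) (hd : d ∣ L) (hfd : f * d ∣ L)
    (ψ : DirichletCharacter ℚ_[p] f) (εK : DirichletCharacter ℚ_[p] d) :
    changeLevel hfd (bernoulliCharOne ψ εK) =
      if ψ.Even then (changeLevel hf ψ)⁻¹ * changeLevel hd εK
      else (changeLevel hf ψ * changeLevel hd εK)⁻¹ * changeLevel hd εK := by
  unfold bernoulliCharOne evenTwist
  have t1 : changeLevel hfd (changeLevel (dvd_mul_right f d) ψ) = changeLevel hf ψ := by
    rw [← changeLevel_trans]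
  have t2 : changeLevel hfd (changeLevel (dvd_mul_left d f) εK) = changeLevel hd εK := by
    rw [← changeLevel_trans]
  split_ifs with h
  · rw [map_mul, map_inv, t1, t2]
  · rw [map_mul, map_inv, map_mul, t1, t2]

/-- Lift of `ψ₀ω⁻¹` (`bernoulliCharTwo`) to a common level. [cite: KrizLi2019, §1.5 (p. 7, ψ₀) and Thm. 1.20 (p. 8)] -/
theorem changeLevel_bernoulliCharTwo {f d L : ℕ} [NeZero L] (hf : f ∣ L) (hd : d ∣ L) (hp' : p ∣ L)
    (hfdp : f * d * p ∣ L) (ψ : DirichletCharacter ℚ_[p] f) (εK : DirichletCharacter ℚ_[p] d)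
    (ω : DirichletCharacter ℚ_[p] p) :
    changeLevel hfdp (bernoulliCharTwo ψ εK ω) =
      (if ψ.Even then changeLevel hf ψ else changeLevel hf ψ * changeLevel hd εK) * (changeLevel hp' ω)⁻¹ := by
  unfold bernoulliCharTwo evenTwist
  have hfd : f * d ∣ L := dvd_trans (dvd_mul_right (f * d) p) hfdp
  have t0 : ∀ χ : DirichletCharacter ℚ_[p] (f * d),
      changeLevel hfdp (changeLevel (dvd_mul_right (f * d) p) χ) = changeLevel hfd χ := by
    intro χ; rw [← changeLevel_trans]
  have t1 : changeLevel hfd (changeLevel (dvd_mul_right f d) ψ) = changeLevel hf ψ := by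
    rw [← changeLevel_trans]
  have t2 : changeLevel hfd (changeLevel (dvd_mul_left d f) εK) = changeLevel hd εK := by
    rw [← changeLevel_trans]
  have t3 : changeLevel hfdp (changeLevel (dvd_mul_left p (f * d)) ω⁻¹) = (changeLevel hp' ω)⁻¹ := by
    rw [← changeLevel_trans, map_inv]
  split_ifs with h
  · rw [map_mul, t0, t3, t1]
  · rw [map_mul, t0, t3, map_mul, t1, t2]

/-- **The Bernoulli pair is intrinsic (same `ψ`).** If `ψ₂↑ = ψ₁↑` at a common level, then the two Bernoulli numbers of
Thm. 1.20 agree for every `ε_K` and `ω`. [cite: KrizLi2019, Thm. 1.20 (p. 8) and §2 (p. 11, primitive characters)] -/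
theorem bernoulliOnePrim_pair_eq_of_eq [NeZero f₁] [NeZero f₂] [NeZero d] [NeZero M]
    (h₁ : f₁ ∣ M) (h₂ : f₂ ∣ M)
    (ψ₁ : DirichletCharacter ℚ_[p] f₁) (ψ₂ : DirichletCharacter ℚ_[p] f₂)
    (εK : DirichletCharacter ℚ_[p] d) (ω : DirichletCharacter ℚ_[p] p)
    (e : changeLevel h₂ ψ₂ = changeLevel h₁ ψ₁) :
    bernoulliOnePrim (bernoulliCharOne ψ₂ εK) = bernoulliOnePrim (bernoulliCharOne ψ₁ εK) ∧
      bernoulliOnePrim (bernoulliCharTwo ψ₂ εK ω) = bernoulliOnePrim (bernoulliCharTwo ψ₁ εK ω) := by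
  haveI : NeZero (M * d * p) := ⟨Nat.mul_ne_zero (Nat.mul_ne_zero (NeZero.ne M) (NeZero.ne d)) hp.out.ne_zero⟩
  -- common level `L = M·d·p`
  have hML : M ∣ M * d * p := Dvd.intro (d * p) (by ring)
  have k₁ : f₁ ∣ M * d * p := dvd_trans h₁ hML
  have k₂ : f₂ ∣ M * d * p := dvd_trans h₂ hML
  have kd : d ∣ M * d * p := Dvd.intro (M * p) (by ring)
  have kp : p ∣ M * d * p := Dvd.intro (M * d) (by ring)
  have k₁d : f₁ * d ∣ M * d * p := dvd_trans (mul_dvd_mul_right h₁ d) (Dvd.intro p rfl)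
  have k₂d : f₂ * d ∣ M * d * p := dvd_trans (mul_dvd_mul_right h₂ d) (Dvd.intro p rfl)
  have k₁dp : f₁ * d * p ∣ M * d * p := mul_dvd_mul_right (mul_dvd_mul_right h₁ d) p
  have k₂dp : f₂ * d * p ∣ M * d * p := mul_dvd_mul_right (mul_dvd_mul_right h₂ d) p
  have e' : changeLevel k₂ ψ₂ = changeLevel k₁ ψ₁ := by
    have t2 : changeLevel k₂ ψ₂ = changeLevel hML (changeLevel h₂ ψ₂) := by rw [← changeLevel_trans]
    have t1 : changeLevel k₁ ψ₁ = changeLevel hML (changeLevel h₁ ψ₁) := by rw [← changeLevel_trans]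
    rw [t2, t1, e]
  have hpar : ψ₂.Even ↔ ψ₁.Even := by
    unfold DirichletCharacter.Even
    rw [← changeLevel_apply_neg_one h₂ ψ₂, ← changeLevel_apply_neg_one h₁ ψ₁, e]
  constructor
  · rw [← RegularLocusBernoulliPair.bernoulliOnePrim_changeLevel k₂d,
      ← RegularLocusBernoulliPair.bernoulliOnePrim_changeLevel k₁d,
      changeLevel_bernoulliCharOne k₂ kd k₂d, changeLevel_bernoulliCharOne k₁ kd k₁d, e']
    by_cases hev : ψ₁.Even
    · rw [if_pos hev, if_pos (hpar.mpr hev)]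
    · rw [if_neg hev, if_neg (fun h => hev (hpar.mp h))]
  · rw [← RegularLocusBernoulliPair.bernoulliOnePrim_changeLevel k₂dp,
      ← RegularLocusBernoulliPair.bernoulliOnePrim_changeLevel k₁dp,
      changeLevel_bernoulliCharTwo k₂ kd kp k₂dp, changeLevel_bernoulliCharTwo k₁ kd kp k₁dp, e']
    by_cases hev : ψ₁.Even
    · rw [if_pos hev, if_pos (hpar.mpr hev)]
    · rw [if_neg hev, if_neg (fun h => hev (hpar.mp h))]

/-- **The Bernoulli pair is intrinsic (swapped `ψ ↔ ψ⁻¹ω`).** If `ψ₂↑ = ψ₁⁻¹↑·ω↑` at a common level and `ω` is odd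
(e.g. Teichmüller, `p` odd), then the two Bernoulli numbers of Thm. 1.20 for `ψ₂` are those for `ψ₁` SWAPPED.
[cite: KrizLi2019, §7.1 (p. 43, «interchange ψ and ψ⁻¹ω») and Thm. 1.20 (p. 8)] -/
theorem bernoulliOnePrim_pair_swap_of_eq [NeZero f₁] [NeZero f₂] [NeZero d] [NeZero M]
    (h₁ : f₁ ∣ M) (h₂ : f₂ ∣ M) (hpM : p ∣ M)
    (ψ₁ : DirichletCharacter ℚ_[p] f₁) (ψ₂ : DirichletCharacter ℚ_[p] f₂)
    (εK : DirichletCharacter ℚ_[p] d) (ω : DirichletCharacter ℚ_[p] p) (hω : ω.Odd)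
    (e : changeLevel h₂ ψ₂ = changeLevel h₁ ψ₁⁻¹ * changeLevel hpM ω) :
    bernoulliOnePrim (bernoulliCharOne ψ₂ εK) = bernoulliOnePrim (bernoulliCharTwo ψ₁ εK ω) ∧
      bernoulliOnePrim (bernoulliCharTwo ψ₂ εK ω) = bernoulliOnePrim (bernoulliCharOne ψ₁ εK) := by
  haveI : NeZero (M * d * p) := ⟨Nat.mul_ne_zero (Nat.mul_ne_zero (NeZero.ne M) (NeZero.ne d)) hp.out.ne_zero⟩
  have hML : M ∣ M * d * p := Dvd.intro (d * p) (by ring)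
  have k₁ : f₁ ∣ M * d * p := dvd_trans h₁ hML
  have k₂ : f₂ ∣ M * d * p := dvd_trans h₂ hML
  have kd : d ∣ M * d * p := Dvd.intro (M * p) (by ring)
  have kp : p ∣ M * d * p := Dvd.intro (M * d) (by ring)
  have k₁d : f₁ * d ∣ M * d * p := dvd_trans (mul_dvd_mul_right h₁ d) (Dvd.intro p rfl)
  have k₂d : f₂ * d ∣ M * d * p := dvd_trans (mul_dvd_mul_right h₂ d) (Dvd.intro p rfl)
  have k₁dp : f₁ * d * p ∣ M * d * p := mul_dvd_mul_right (mul_dvd_mul_right h₁ d) p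
  have k₂dp : f₂ * d * p ∣ M * d * p := mul_dvd_mul_right (mul_dvd_mul_right h₂ d) p
  have e' : changeLevel k₂ ψ₂ = (changeLevel k₁ ψ₁)⁻¹ * changeLevel kp ω := by
    have t2 : changeLevel k₂ ψ₂ = changeLevel hML (changeLevel h₂ ψ₂) := by rw [← changeLevel_trans]
    have t1 : changeLevel k₁ ψ₁ = changeLevel hML (changeLevel h₁ ψ₁) := by rw [← changeLevel_trans]
    have tp : changeLevel kp ω = changeLevel hML (changeLevel hpM ω) := by rw [← changeLevel_trans]
    rw [t2, t1, tp, e, map_mul, map_inv (changeLevel h₁), map_inv (changeLevel hML)]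
  -- parities are opposite
  have hval : ψ₂ (-1) = -(ψ₁ (-1)) := by
    rw [← changeLevel_apply_neg_one h₂ ψ₂, e, MulChar.mul_apply, changeLevel_apply_neg_one hpM ω, hω,
      map_inv (changeLevel h₁), MulChar.inv_apply_eq_inv', changeLevel_apply_neg_one h₁ ψ₁]
    rcases ψ₁.even_or_odd with h | h
    · rw [h]; norm_num
    · rw [h]; norm_num
  constructor
  · rw [← RegularLocusBernoulliPair.bernoulliOnePrim_changeLevel k₂d,
      ← RegularLocusBernoulliPair.bernoulliOnePrim_changeLevel k₁dp,
      changeLevel_bernoulliCharOne k₂ kd k₂d, changeLevel_bernoulliCharTwo k₁ kd kp k₁dp, e']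
    rcases ψ₁.even_or_odd with hev | hodd
    · have h2 : ¬ ψ₂.Even := by
        apply not_even_of_odd'; unfold DirichletCharacter.Odd; rw [hval, hev]
      rw [if_neg h2, if_pos hev, cg_swap_one]
    · have h2 : ψ₂.Even := by
        unfold DirichletCharacter.Even; rw [hval, hodd, neg_neg]
      rw [if_pos h2, if_neg (not_even_of_odd' ψ₁ hodd), cg_swap_two]
  · rw [← RegularLocusBernoulliPair.bernoulliOnePrim_changeLevel k₂dp,
      ← RegularLocusBernoulliPair.bernoulliOnePrim_changeLevel k₁d,
      changeLevel_bernoulliCharTwo k₂ kd kp k₂dp, changeLevel_bernoulliCharOne k₁ kd k₁d, e']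
    rcases ψ₁.even_or_odd with hev | hodd
    · have h2 : ¬ ψ₂.Even := by
        apply not_even_of_odd'; unfold DirichletCharacter.Odd; rw [hval, hev]
      rw [if_neg h2, if_pos hev, cg_swap_three]
    · have h2 : ψ₂.Even := by
        unfold DirichletCharacter.Even; rw [hval, hodd, neg_neg]
      rw [if_pos h2, if_neg (not_even_of_odd' ψ₁ hodd), cg_swap_four]

/-- **KRIZ–LI'S HYPOTHESIS (4) IS INTRINSIC.** Let `p` be odd, `ω` an odd character mod `p` (e.g. Teichmüller), and let
`(f₁, ψ₁)`, `(f₂, ψ₂)` be two character data whose trace forms agree modulo `p` at every prime `ℓ ∤ N` (two `hss` for the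
same curve). Then for every `ε_K`: the PRODUCT `B_{1,ψ₀⁻¹ε_K}·B_{1,ψ₀ω⁻¹}` of Thm. 1.20 is the same for `ψ₂` as for `ψ₁`;
in particular hypothesis (4) `¬ ‖B·B'‖ ≤ p⁻¹` holds for `ψ₂` iff it holds for `ψ₁`. [cite: KrizLi2019, Thm. 1.20 (p. 8) and §7.1 (p. 43)] -/
theorem bernoulliOnePrim_prod_eq_of_traceForm_congr (hp2 : p ≠ 2) [NeZero f₁] [NeZero f₂] [NeZero d]
    (ψ₁ : DirichletCharacter ℚ_[p] f₁) (ψ₂ : DirichletCharacter ℚ_[p] f₂)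
    (εK : DirichletCharacter ℚ_[p] d) (ω : DirichletCharacter ℚ_[p] p) (hω : ω.Odd)
    {N : ℕ} (hN : N ≠ 0)
    (h : ∀ ℓ : ℕ, ℓ.Prime → ¬ ℓ ∣ N →
      ‖(ψ₁ (ℓ : ZMod f₁) + ψ₁⁻¹ (ℓ : ZMod f₁) * ω (ℓ : ZMod p)) -
        (ψ₂ (ℓ : ZMod f₂) + ψ₂⁻¹ (ℓ : ZMod f₂) * ω (ℓ : ZMod p))‖ < 1) :
    bernoulliOnePrim (bernoulliCharOne ψ₂ εK) * bernoulliOnePrim (bernoulliCharTwo ψ₂ εK ω) =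
      bernoulliOnePrim (bernoulliCharOne ψ₁ εK) * bernoulliOnePrim (bernoulliCharTwo ψ₁ εK ω) := by
  haveI : NeZero (f₁ * f₂ * p) := ⟨Nat.mul_ne_zero (Nat.mul_ne_zero (NeZero.ne f₁) (NeZero.ne f₂)) hp.out.ne_zero⟩
  have h₁ : f₁ ∣ f₁ * f₂ * p := Dvd.intro (f₂ * p) (by ring)
  have h₂ : f₂ ∣ f₁ * f₂ * p := Dvd.intro (f₁ * p) (by ring)
  have hpM : p ∣ f₁ * f₂ * p := Dvd.intro (f₁ * f₂) (by ring)
  rcases eq_or_eq_of_traceForm_congr hp2 h₁ h₂ hpM ψ₁ ψ₂ ω hN h with e | e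
  · obtain ⟨e1, e2⟩ := bernoulliOnePrim_pair_eq_of_eq h₁ h₂ ψ₁ ψ₂ εK ω e
    rw [e1, e2]
  · obtain ⟨e1, e2⟩ := bernoulliOnePrim_pair_swap_of_eq h₁ h₂ hpM ψ₁ ψ₂ εK ω hω e
    rw [e1, e2, mul_comm]

/-- **Hypothesis (4) transfers between admissible character data** (iff form). [cite: KrizLi2019, Thm. 1.20 (p. 8) and §7.1 (p. 43)] -/
theorem krizLi_hypothesis_four_iff_of_traceForm_congr (hp2 : p ≠ 2) [NeZero f₁] [NeZero f₂] [NeZero d]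
    (ψ₁ : DirichletCharacter ℚ_[p] f₁) (ψ₂ : DirichletCharacter ℚ_[p] f₂)
    (εK : DirichletCharacter ℚ_[p] d) (ω : DirichletCharacter ℚ_[p] p) (hω : ω.Odd)
    {N : ℕ} (hN : N ≠ 0)
    (h : ∀ ℓ : ℕ, ℓ.Prime → ¬ ℓ ∣ N →
      ‖(ψ₁ (ℓ : ZMod f₁) + ψ₁⁻¹ (ℓ : ZMod f₁) * ω (ℓ : ZMod p)) -
        (ψ₂ (ℓ : ZMod f₂) + ψ₂⁻¹ (ℓ : ZMod f₂) * ω (ℓ : ZMod p))‖ < 1) :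
    (¬ ‖bernoulliOnePrim (bernoulliCharOne ψ₂ εK) * bernoulliOnePrim (bernoulliCharTwo ψ₂ εK ω)‖ ≤ (p : ℝ)⁻¹) ↔
      ¬ ‖bernoulliOnePrim (bernoulliCharOne ψ₁ εK) * bernoulliOnePrim (bernoulliCharTwo ψ₁ εK ω)‖ ≤ (p : ℝ)⁻¹ := by
  rw [bernoulliOnePrim_prod_eq_of_traceForm_congr hp2 ψ₁ ψ₂ εK ω hω hN h]

end Bernoulli

/-! ## §5 WLOG `ψ` ODD: every Kriz–Li character datum of a class member may be replaced by w3 g2's explicit odd one -/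

/-- Two trace forms `hss` for the SAME curve and the same `ω` are congruent modulo `p` at every prime `ℓ ∤ pN_W`
(ultrametric inequality) — the input shape of `eq_or_eq_of_traceForm_congr`. [folklore] -/
theorem traceForm_congr_of_hss {f₁ f₂ : ℕ} (W : WeierstrassCurve ℚ)
    (ψ₁ : DirichletCharacter ℚ_[p] f₁) (ψ₂ : DirichletCharacter ℚ_[p] f₂) (ω : DirichletCharacter ℚ_[p] p)
    (h₁ : ∀ ℓ : ℕ, ℓ.Prime → ¬ (ℓ ∣ p * W.conductorNorm ℤ) →
      ‖((W.LFunction ℓ : ℤ) : ℚ_[p]) - (ψ₁ (ℓ : ZMod f₁) + ψ₁⁻¹ (ℓ : ZMod f₁) * ω (ℓ : ZMod p))‖ < 1)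
    (h₂ : ∀ ℓ : ℕ, ℓ.Prime → ¬ (ℓ ∣ p * W.conductorNorm ℤ) →
      ‖((W.LFunction ℓ : ℤ) : ℚ_[p]) - (ψ₂ (ℓ : ZMod f₂) + ψ₂⁻¹ (ℓ : ZMod f₂) * ω (ℓ : ZMod p))‖ < 1) :
    ∀ ℓ : ℕ, ℓ.Prime → ¬ ℓ ∣ p * W.conductorNorm ℤ →
      ‖(ψ₁ (ℓ : ZMod f₁) + ψ₁⁻¹ (ℓ : ZMod f₁) * ω (ℓ : ZMod p)) -
        (ψ₂ (ℓ : ZMod f₂) + ψ₂⁻¹ (ℓ : ZMod f₂) * ω (ℓ : ZMod p))‖ < 1 := by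
  intro ℓ hℓ hℓN
  have e : (ψ₁ (ℓ : ZMod f₁) + ψ₁⁻¹ (ℓ : ZMod f₁) * ω (ℓ : ZMod p)) -
        (ψ₂ (ℓ : ZMod f₂) + ψ₂⁻¹ (ℓ : ZMod f₂) * ω (ℓ : ZMod p)) =
      (((W.LFunction ℓ : ℤ) : ℚ_[p]) - (ψ₂ (ℓ : ZMod f₂) + ψ₂⁻¹ (ℓ : ZMod f₂) * ω (ℓ : ZMod p))) -
        (((W.LFunction ℓ : ℤ) : ℚ_[p]) - (ψ₁ (ℓ : ZMod f₁) + ψ₁⁻¹ (ℓ : ZMod f₁) * ω (ℓ : ZMod p))) := by ring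
  rw [e, sub_eq_add_neg]
  refine lt_of_le_of_lt (IsUltrametricDist.norm_add_le_max _ _) (max_lt (h₂ ℓ hℓ hℓN) ?_)
  rw [norm_neg]; exact h₁ ℓ hℓ hℓN

/-- **Hypothesis (4) is the same for ALL character data of one class member.** For `W` with CM, `p ≥ 5` CM-ramified, a
Teichmüller `ω`, two character data `(f₁, ψ₁)`, `(f₂, ψ₂)` both with Kriz–Li's trace form `hss` for `W`, and any `ε_K`: the
product `B_{1,ψ₀⁻¹ε_K}·B_{1,ψ₀ω⁻¹}` is the same for `ψ₁` and `ψ₂`. [cite: KrizLi2019, Thm. 1.20 (p. 8) and §7.1 (p. 43)] -/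
theorem bernoulliOnePrim_prod_eq_of_hss (h5 : 5 ≤ p) (W : WeierstrassCurve ℚ) [W.IsElliptic] {f₁ f₂ d : ℕ}
    [NeZero f₁] [NeZero f₂] [NeZero d] (ψ₁ : DirichletCharacter ℚ_[p] f₁) (ψ₂ : DirichletCharacter ℚ_[p] f₂)
    (ω : DirichletCharacter ℚ_[p] p) (hω : IsTeichmullerCharacter ω) (εK : DirichletCharacter ℚ_[p] d)
    (h₁ : ∀ ℓ : ℕ, ℓ.Prime → ¬ (ℓ ∣ p * W.conductorNorm ℤ) →
      ‖((W.LFunction ℓ : ℤ) : ℚ_[p]) - (ψ₁ (ℓ : ZMod f₁) + ψ₁⁻¹ (ℓ : ZMod f₁) * ω (ℓ : ZMod p))‖ < 1)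
    (h₂ : ∀ ℓ : ℕ, ℓ.Prime → ¬ (ℓ ∣ p * W.conductorNorm ℤ) →
      ‖((W.LFunction ℓ : ℤ) : ℚ_[p]) - (ψ₂ (ℓ : ZMod f₂) + ψ₂⁻¹ (ℓ : ZMod f₂) * ω (ℓ : ZMod p))‖ < 1) :
    bernoulliOnePrim (bernoulliCharOne ψ₂ εK) * bernoulliOnePrim (bernoulliCharTwo ψ₂ εK ω) =
      bernoulliOnePrim (bernoulliCharOne ψ₁ εK) * bernoulliOnePrim (bernoulliCharTwo ψ₁ εK ω) := by
  have hp2 : p ≠ 2 := by omega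
  have hN0 : p * W.conductorNorm ℤ ≠ 0 := Nat.mul_ne_zero hp.out.ne_zero (W.conductorNorm_pos_holds).ne'
  exact bernoulliOnePrim_prod_eq_of_traceForm_congr hp2 ψ₁ ψ₂ εK ω (KrizLiBinders.teichmuller_apply_neg_one hp2 hω)
    hN0 (traceForm_congr_of_hss W ψ₁ ψ₂ ω h₁ h₂)

/-- **WLOG `ψ` IS ODD (and explicit).** Let `W/ℚ` be elliptic with CM, `p ≥ 5` CM-ramified, `ω` Teichmüller. If SOME character
datum `(f, ψ)` has the trace form `hss` for `W` and satisfies Kriz–Li's hypothesis (4) with a given `ε_K`, then so does an ODD,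
PRIMITIVE `ψ₀` carrying ALSO hypotheses (1) and (3) — namely w3 g2's class character `ψ₀ = χ_e·ω^k` of
`KrizLiBinders.krizLiBinders_of_cmRamified`: the Bernoulli product is intrinsic (uniqueness of the Eisenstein pair). For Stub H
(`stub_bottomResidualSelmer_trivial_of_bernoulliPair`, registry v10) this is the printed «we may assume ψ ≠ ω … interchange ψ and
ψ⁻¹ω»: the six-term bookkeeping `b₁ = B_{1,ψ⁻¹}`, `b₂ = B_{1,ψε_Kω⁻¹}` may always be run with `ψ` odd.
[cite: KrizLi2019, Thm. 1.20 (pp. 7–8), §7.1 (p. 43)] [cite: Mazur1978, Prop. 6.3 (1) (p. 153)] -/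
theorem exists_odd_krizLiData_of_hss (W : WeierstrassCurve ℚ) [W.IsElliptic] (hCM : W.HasCM) (hram : CMRamified W p)
    (h5 : 5 ≤ p) (ω : DirichletCharacter ℚ_[p] p) (hω : IsTeichmullerCharacter ω)
    {f : ℕ} [NeZero f] (ψ : DirichletCharacter ℚ_[p] f)
    (hss : ∀ ℓ : ℕ, ℓ.Prime → ¬ (ℓ ∣ p * W.conductorNorm ℤ) →
      ‖((W.LFunction ℓ : ℤ) : ℚ_[p]) - (ψ (ℓ : ZMod f) + ψ⁻¹ (ℓ : ZMod f) * ω (ℓ : ZMod p))‖ < 1)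
    {d : ℕ} [NeZero d] (εK : DirichletCharacter ℚ_[p] d)
    (h4 : ¬ ‖bernoulliOnePrim (bernoulliCharOne ψ εK) * bernoulliOnePrim (bernoulliCharTwo ψ εK ω)‖ ≤ (p : ℝ)⁻¹) :
    ∃ (f₀ : ℕ) (_ : NeZero f₀) (ψ₀ : DirichletCharacter ℚ_[p] f₀),
      ψ₀.IsPrimitive ∧ ψ₀.Odd ∧
      (∀ ℓ : ℕ, ℓ.Prime → ¬ (ℓ ∣ p * W.conductorNorm ℤ) →
        ‖((W.LFunction ℓ : ℤ) : ℚ_[p]) - (ψ₀ (ℓ : ZMod f₀) + ψ₀⁻¹ (ℓ : ZMod f₀) * ω (ℓ : ZMod p))‖ < 1) ∧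
      (ψ₀ (p : ZMod f₀) ≠ 1 ∧ primVal (invMulOmega ψ₀ ω) p ≠ 1) ∧
      (∀ ℓ : ℕ, (hℓ : ℓ.Prime) → ℓ ≠ p →
        (haveI := Fact.mk hℓ; ¬ W.HasGoodReductionAtPrime ℓ ∧ ¬ W.HasMultiplicativeReductionAtPrime ℓ) →
        ψ₀ (ℓ : ZMod f₀) ≠ 1 ∧ primVal (invMulOmega ψ₀ ω) ℓ ≠ 1) ∧
      ¬ ‖bernoulliOnePrim (bernoulliCharOne ψ₀ εK) * bernoulliOnePrim (bernoulliCharTwo ψ₀ εK ω)‖ ≤ (p : ℝ)⁻¹ := by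
  obtain ⟨f₀, hf₀, ψ₀, hprim, hodd, hss₀, h1, h3⟩ := KrizLiBinders.krizLiBinders_of_cmRamified W hCM hram h5 ω hω
  refine ⟨f₀, hf₀, ψ₀, hprim, hodd, hss₀, h1, h3, ?_⟩
  rw [bernoulliOnePrim_prod_eq_of_hss h5 W ψ ψ₀ ω hω εK hss hss₀]
  exact h4

/-- **Conversely, (4) FAILS for every datum as soon as it fails for ONE character with `hss`** (e.g. the explicit class
character): the contrapositive used off the locus (`…OffLocusNoKrizLiDatum11`). [cite: KrizLi2019, Thm. 1.20 (p. 8) and §7.1 (p. 43)] -/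
theorem krizLi_hypothesis_four_fails_of_hss (h5 : 5 ≤ p) (W : WeierstrassCurve ℚ) [W.IsElliptic] {f₁ f₂ d : ℕ}
    [NeZero f₁] [NeZero f₂] [NeZero d] (ψ₁ : DirichletCharacter ℚ_[p] f₁) (ψ₂ : DirichletCharacter ℚ_[p] f₂)
    (ω : DirichletCharacter ℚ_[p] p) (hω : IsTeichmullerCharacter ω) (εK : DirichletCharacter ℚ_[p] d)
    (h₁ : ∀ ℓ : ℕ, ℓ.Prime → ¬ (ℓ ∣ p * W.conductorNorm ℤ) →
      ‖((W.LFunction ℓ : ℤ) : ℚ_[p]) - (ψ₁ (ℓ : ZMod f₁) + ψ₁⁻¹ (ℓ : ZMod f₁) * ω (ℓ : ZMod p))‖ < 1)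
    (h₂ : ∀ ℓ : ℕ, ℓ.Prime → ¬ (ℓ ∣ p * W.conductorNorm ℤ) →
      ‖((W.LFunction ℓ : ℤ) : ℚ_[p]) - (ψ₂ (ℓ : ZMod f₂) + ψ₂⁻¹ (ℓ : ZMod f₂) * ω (ℓ : ZMod p))‖ < 1)
    (hfail : ‖bernoulliOnePrim (bernoulliCharOne ψ₁ εK) * bernoulliOnePrim (bernoulliCharTwo ψ₁ εK ω)‖ ≤ (p : ℝ)⁻¹) :
    ‖bernoulliOnePrim (bernoulliCharOne ψ₂ εK) * bernoulliOnePrim (bernoulliCharTwo ψ₂ εK ω)‖ ≤ (p : ℝ)⁻¹ := by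
  rw [bernoulliOnePrim_prod_eq_of_hss h5 W ψ₁ ψ₂ ω hω εK h₁ h₂]
  exact hfail

end Summit.BirchSwinnertonDyer.BirchSwinnertonDyer.Theorems.PrintCFram.EisensteinPair

end
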